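import Mathlib
import HarnessLib

/-!
# Route `PoloidalWindowDoor`, crux `PoloidalWindowRigidity` (K2, stmt-NavierStokesRegularity-19708) — LINE 7 `period_door`
# (ns-idea-8 g3, v3), geometry for STUB D1F `stub_killingOfDiscreteRotation`, part 1: rotations of `ℝ³` about an axis and the
# normal form of a linear isometry of `ℝ³` fixing a unit vector

Cell ns-regularity-ideate, seat ns-poloidal-K2-p2 g12 (stub-worker on K2; `--supports` the crux item).  Pure finite-dimensional
geometry on `ℝ³ = EuclideanSpace ℝ (Fin 3)`, consumed by `…PoloidalWindowDoorPoloidalWindowRigidityKillingOfDiscreteRotation`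
(the stub itself): the explicit one-parameter rotation family about an axis built from an orthonormal pair `(u, w)`,
`R_θ y = y + (cos θ − 1)(⟪u,y⟫u + ⟪w,y⟫w) + sin θ (⟪u,y⟫w − ⟪w,y⟫u)` — coordinates (`inner_u_rot`, `inner_w_rot`), group law
(`rot_add`), `rot_zero`, `rot_int_mul_two_pi`, continuity (`continuous_rot`) and the angular derivative at `0`
(`hasDerivAt_rot_zero`, the skew generator `⟪u,y⟫w − ⟪w,y⟫u`); an orthonormal frame through a unit vector
(`exists_frame`); and the normal form of an isometry fixing a unit vector (`rotation_of_fix`: a rotation of the family, or an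
involution).  The axis itself (`A e = ± e`) is the tree's
`Summit.NavierStokesRegularity.AngularGalerkinLadderTransversalUnboundedAlongAxis.exists_axis` (reused by the consumer, not restated).  The family is passed as a hypothesis
`hR : ∀ θ y, R θ y = …` (no definitions are introduced).

WHAT THIS IS NOT: not a claim about Navier–Stokes regularity — linear algebra for one provable stub of an ideator line of a
door route (bears_on LADDER-NS N0, rung N0-LocalTubeDoorPoloidal); crux 19708 is OPEN.
-/

noncomputable section

-- the summit and its single sub-problem share the name (CONVENTIONS §1), as in every Theorems file
set_option linter.dupNamespace false

namespace Summit.NavierStokesRegularity.NavierStokesRegularity.Theorems.PoloidalWindowDoorPoloidalWindowRigidityIsometryAxisRotation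

open scoped RealInnerProductSpace InnerProductSpace
open Set Function Filter Topology Module

variable {u w : EuclideanSpace ℝ (Fin 3)}

/-- Coordinate of the rotated vector `R_θ y` along `u`: `cos θ ⟪u,y⟫ − sin θ ⟪w,y⟫` (orthonormal pair `(u, w)`). [folklore] -/
theorem inner_u_rot (hu : ‖u‖ = 1) (huw : ⟪u, w⟫_ℝ = 0) (θ : ℝ) (y : EuclideanSpace ℝ (Fin 3)) :
    ⟪u, y + (Real.cos θ - 1) • (⟪u, y⟫_ℝ • u + ⟪w, y⟫_ℝ • w) + Real.sin θ • (⟪u, y⟫_ℝ • w - ⟪w, y⟫_ℝ • u)⟫_ℝ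
      = Real.cos θ * ⟪u, y⟫_ℝ - Real.sin θ * ⟪w, y⟫_ℝ := by
  have huu : ⟪u, u⟫_ℝ = 1 := by rw [real_inner_self_eq_norm_sq, hu, one_pow]
  simp only [inner_add_right, inner_sub_right, inner_smul_right, huu, huw]
  ring

/-- Coordinate of the rotated vector `R_θ y` along `w`: `sin θ ⟪u,y⟫ + cos θ ⟪w,y⟫` (orthonormal pair `(u, w)`). [folklore] -/
theorem inner_w_rot (hw : ‖w‖ = 1) (huw : ⟪u, w⟫_ℝ = 0) (θ : ℝ) (y : EuclideanSpace ℝ (Fin 3)) :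
    ⟪w, y + (Real.cos θ - 1) • (⟪u, y⟫_ℝ • u + ⟪w, y⟫_ℝ • w) + Real.sin θ • (⟪u, y⟫_ℝ • w - ⟪w, y⟫_ℝ • u)⟫_ℝ
      = Real.sin θ * ⟪u, y⟫_ℝ + Real.cos θ * ⟪w, y⟫_ℝ := by
  have hww : ⟪w, w⟫_ℝ = 1 := by rw [real_inner_self_eq_norm_sq, hw, one_pow]
  have hwu : ⟪w, u⟫_ℝ = 0 := by rw [real_inner_comm]; exact huw
  simp only [inner_add_right, inner_sub_right, inner_smul_right, hww, hwu]
  ring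

/-- The group law `R_θ ∘ R_φ = R_{θ+φ}` of the explicit rotation family about the axis orthogonal to the orthonormal pair `(u, w)`. [folklore] -/
theorem rot_add {R : ℝ → EuclideanSpace ℝ (Fin 3) → EuclideanSpace ℝ (Fin 3)}
    (hR : ∀ θ y, R θ y = y + (Real.cos θ - 1) • (⟪u, y⟫_ℝ • u + ⟪w, y⟫_ℝ • w)
      + Real.sin θ • (⟪u, y⟫_ℝ • w - ⟪w, y⟫_ℝ • u))
    (hu : ‖u‖ = 1) (hw : ‖w‖ = 1) (huw : ⟪u, w⟫_ℝ = 0) (θ φ : ℝ) (y : EuclideanSpace ℝ (Fin 3)) :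
    R θ (R φ y) = R (θ + φ) y := by
  rw [hR θ, hR φ, inner_u_rot hu huw, inner_w_rot hw huw, ← hR φ, hR (θ + φ), hR φ,
    Real.cos_add, Real.sin_add]
  module

/-- `R_0 = id`. [folklore] -/
theorem rot_zero {R : ℝ → EuclideanSpace ℝ (Fin 3) → EuclideanSpace ℝ (Fin 3)}
    (hR : ∀ θ y, R θ y = y + (Real.cos θ - 1) • (⟪u, y⟫_ℝ • u + ⟪w, y⟫_ℝ • w)
      + Real.sin θ • (⟪u, y⟫_ℝ • w - ⟪w, y⟫_ℝ • u)) (y : EuclideanSpace ℝ (Fin 3)) :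
    R 0 y = y := by
  rw [hR, Real.cos_zero, Real.sin_zero]; simp

/-- Full turns are the identity: `R_{2πm} = id` for `m ∈ ℤ`. [folklore] -/
theorem rot_int_mul_two_pi {R : ℝ → EuclideanSpace ℝ (Fin 3) → EuclideanSpace ℝ (Fin 3)}
    (hR : ∀ θ y, R θ y = y + (Real.cos θ - 1) • (⟪u, y⟫_ℝ • u + ⟪w, y⟫_ℝ • w)
      + Real.sin θ • (⟪u, y⟫_ℝ • w - ⟪w, y⟫_ℝ • u)) (m : ℤ) (y : EuclideanSpace ℝ (Fin 3)) :
    R (m * (2 * Real.pi)) y = y := by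
  have h1 : Real.sin (m * (2 * Real.pi)) = 0 := by
    rw [show (m : ℝ) * (2 * Real.pi) = ((2 * m : ℤ) : ℝ) * Real.pi by push_cast; ring]
    exact Real.sin_int_mul_pi _
  rw [hR, Real.cos_int_mul_two_pi, h1]; simp

/-- `θ ↦ R_θ y` is continuous. [folklore] -/
theorem continuous_rot {R : ℝ → EuclideanSpace ℝ (Fin 3) → EuclideanSpace ℝ (Fin 3)}
    (hR : ∀ θ y, R θ y = y + (Real.cos θ - 1) • (⟪u, y⟫_ℝ • u + ⟪w, y⟫_ℝ • w)
      + Real.sin θ • (⟪u, y⟫_ℝ • w - ⟪w, y⟫_ℝ • u)) (y : EuclideanSpace ℝ (Fin 3)) :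
    Continuous fun θ => R θ y := by
  have : (fun θ => R θ y) = fun θ => y + (Real.cos θ - 1) • (⟪u, y⟫_ℝ • u + ⟪w, y⟫_ℝ • w)
      + Real.sin θ • (⟪u, y⟫_ℝ • w - ⟪w, y⟫_ℝ • u) := funext fun θ => hR θ y
  rw [this]
  fun_prop

/-- The angular derivative of `θ ↦ R_θ y` at `θ = 0` is the skew generator `⟪u,y⟫ w − ⟪w,y⟫ u`. [folklore] -/
theorem hasDerivAt_rot_zero {R : ℝ → EuclideanSpace ℝ (Fin 3) → EuclideanSpace ℝ (Fin 3)}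
    (hR : ∀ θ y, R θ y = y + (Real.cos θ - 1) • (⟪u, y⟫_ℝ • u + ⟪w, y⟫_ℝ • w)
      + Real.sin θ • (⟪u, y⟫_ℝ • w - ⟪w, y⟫_ℝ • u)) (y : EuclideanSpace ℝ (Fin 3)) :
    HasDerivAt (fun θ => R θ y) (⟪u, y⟫_ℝ • w - ⟪w, y⟫_ℝ • u) 0 := by
  have : (fun θ => R θ y) = fun θ => y + (Real.cos θ - 1) • (⟪u, y⟫_ℝ • u + ⟪w, y⟫_ℝ • w)
      + Real.sin θ • (⟪u, y⟫_ℝ • w - ⟪w, y⟫_ℝ • u) := funext fun θ => hR θ y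
  rw [this]
  have h1 : HasDerivAt (fun θ => Real.cos θ - 1) (-Real.sin 0) 0 := (Real.hasDerivAt_cos 0).sub_const 1
  have h2 : HasDerivAt (fun θ => y + (Real.cos θ - 1) • (⟪u, y⟫_ℝ • u + ⟪w, y⟫_ℝ • w)
      + Real.sin θ • (⟪u, y⟫_ℝ • w - ⟪w, y⟫_ℝ • u))
      ((-Real.sin 0) • (⟪u, y⟫_ℝ • u + ⟪w, y⟫_ℝ • w) + Real.cos 0 • (⟪u, y⟫_ℝ • w - ⟪w, y⟫_ℝ • u)) 0 :=
    ((h1.smul_const (⟪u, y⟫_ℝ • u + ⟪w, y⟫_ℝ • w)).const_add y).add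
      ((Real.hasDerivAt_sin 0).smul_const (⟪u, y⟫_ℝ • w - ⟪w, y⟫_ℝ • u))
  refine h2.congr_deriv ?_
  simp


/-- An orthonormal frame `(u, w, e)` of `ℝ³` through a given unit vector `e`, with the expansion
`y = ⟪u,y⟫ u + ⟪w,y⟫ w + ⟪e,y⟫ e` (dimension count for the orthogonal complements, `OrthonormalBasis.mk`, `sum_repr'`). [folklore] -/
theorem exists_frame (e : EuclideanSpace ℝ (Fin 3)) (he : ‖e‖ = 1) :
    ∃ u w : EuclideanSpace ℝ (Fin 3), ‖u‖ = 1 ∧ ‖w‖ = 1 ∧ ⟪u, w⟫_ℝ = 0 ∧ ⟪e, u⟫_ℝ = 0 ∧ ⟪e, w⟫_ℝ = 0 ∧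
      ∀ y, ⟪u, y⟫_ℝ • u + ⟪w, y⟫_ℝ • w + ⟪e, y⟫_ℝ • e = y := by
  have he0 : e ≠ 0 := by
    intro h; rw [h, norm_zero] at he; exact zero_ne_one he
  have hfin : finrank ℝ (EuclideanSpace ℝ (Fin 3)) = 3 := finrank_euclideanSpace_fin
  -- a unit vector orthogonal to `e`
  have hK : (ℝ ∙ e)ᗮ ≠ ⊥ := by
    intro hbot
    have h1 := Submodule.finrank_add_finrank_orthogonal (ℝ ∙ e)
    rw [hbot, finrank_bot, finrank_span_singleton he0, hfin] at h1
    omega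
  obtain ⟨u₀, hu₀K, hu₀⟩ := Submodule.exists_mem_ne_zero_of_ne_bot hK
  have heu₀ : ⟪e, u₀⟫_ℝ = 0 := (Submodule.mem_orthogonal_singleton_iff_inner_right).1 hu₀K
  set u : EuclideanSpace ℝ (Fin 3) := ‖u₀‖⁻¹ • u₀ with hu_def
  have hu : ‖u‖ = 1 := by
    rw [hu_def, norm_smul, norm_inv, norm_norm, inv_mul_cancel₀ (norm_ne_zero_iff.2 hu₀)]
  have heu : ⟪e, u⟫_ℝ = 0 := by rw [hu_def, real_inner_smul_right, heu₀, mul_zero]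
  -- a unit vector orthogonal to `e` and `u`
  have hW : (Submodule.span ℝ ({e, u} : Set (EuclideanSpace ℝ (Fin 3))))ᗮ ≠ ⊥ := by
    intro hbot
    have h1 := Submodule.finrank_add_finrank_orthogonal
      (Submodule.span ℝ ({e, u} : Set (EuclideanSpace ℝ (Fin 3))))
    rw [hbot, finrank_bot, hfin] at h1
    have h2 : finrank ℝ (Submodule.span ℝ (({e, u} : Finset (EuclideanSpace ℝ (Fin 3))) :
        Set (EuclideanSpace ℝ (Fin 3)))) ≤ ({e, u} : Finset (EuclideanSpace ℝ (Fin 3))).card :=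
      finrank_span_finset_le_card _
    have h3 : ({e, u} : Finset (EuclideanSpace ℝ (Fin 3))).card ≤ 2 := Finset.card_le_two
    rw [Finset.coe_insert, Finset.coe_singleton] at h2
    omega
  obtain ⟨w₀, hw₀W, hw₀⟩ := Submodule.exists_mem_ne_zero_of_ne_bot hW
  rw [Submodule.mem_orthogonal] at hw₀W
  have hew₀ : ⟪e, w₀⟫_ℝ = 0 := hw₀W e (Submodule.subset_span (by simp))
  have huw₀ : ⟪u, w₀⟫_ℝ = 0 := hw₀W u (Submodule.subset_span (by simp))
  set w : EuclideanSpace ℝ (Fin 3) := ‖w₀‖⁻¹ • w₀ with hw_def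
  have hw : ‖w‖ = 1 := by
    rw [hw_def, norm_smul, norm_inv, norm_norm, inv_mul_cancel₀ (norm_ne_zero_iff.2 hw₀)]
  have hew : ⟪e, w⟫_ℝ = 0 := by rw [hw_def, real_inner_smul_right, hew₀, mul_zero]
  have huw : ⟪u, w⟫_ℝ = 0 := by rw [hw_def, real_inner_smul_right, huw₀, mul_zero]
  -- the orthonormal basis `(u, w, e)`
  have hon : Orthonormal ℝ ![u, w, e] := by
    rw [orthonormal_iff_ite]
    have hwu : ⟪w, u⟫_ℝ = 0 := by rw [real_inner_comm]; exact huw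
    have hue : ⟪u, e⟫_ℝ = 0 := by rw [real_inner_comm]; exact heu
    have hwe : ⟪w, e⟫_ℝ = 0 := by rw [real_inner_comm]; exact hew
    intro i j
    fin_cases i <;> fin_cases j <;> simp [hu, hw, he, huw, hwu, heu, hue, hew, hwe]
  have hsp : ⊤ ≤ Submodule.span ℝ (Set.range ![u, w, e]) :=
    (hon.linearIndependent.span_eq_top_of_card_eq_finrank' (by rw [hfin]; simp)).ge
  let b := OrthonormalBasis.mk hon hsp
  refine ⟨u, w, hu, hw, huw, heu, hew, fun y => ?_⟩
  have h := b.sum_repr' y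
  rw [Fin.sum_univ_three] at h
  simpa [b, OrthonormalBasis.coe_mk] using h


/-- **Normal form of a linear isometry of `ℝ³` fixing a unit vector `e`** that is not an involution: in an orthonormal frame
`(u, w, e)` it is the rotation `y ↦ y + (a − 1)(⟪u,y⟫u + ⟪w,y⟫w) + b(⟪u,y⟫w − ⟪w,y⟫u)` with `a² + b² = 1` (`B u = a u + b w`,
`B w = λ(−b u + a w)`, `λ = ± 1` by orthonormality of `(B u, B w)`; `λ = −1` makes `B` an involution). [folklore] -/
theorem rotation_of_fix (B : EuclideanSpace ℝ (Fin 3) ≃ₗᵢ[ℝ] EuclideanSpace ℝ (Fin 3))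
    {e u w : EuclideanSpace ℝ (Fin 3)} (hu : ‖u‖ = 1) (hw : ‖w‖ = 1)
    (huw : ⟪u, w⟫_ℝ = 0) (heu : ⟪e, u⟫_ℝ = 0) (hew : ⟪e, w⟫_ℝ = 0)
    (hexp : ∀ y, ⟪u, y⟫_ℝ • u + ⟪w, y⟫_ℝ • w + ⟪e, y⟫_ℝ • e = y)
    (hBe : B e = e) (hB2 : ∃ x, B (B x) ≠ x) :
    ∃ a b : ℝ, a ^ 2 + b ^ 2 = 1 ∧
      ∀ y, B y = y + (a - 1) • (⟪u, y⟫_ℝ • u + ⟪w, y⟫_ℝ • w) + b • (⟪u, y⟫_ℝ • w - ⟪w, y⟫_ℝ • u) := by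
  have huu : ⟪u, u⟫_ℝ = 1 := by rw [real_inner_self_eq_norm_sq, hu, one_pow]
  have hww : ⟪w, w⟫_ℝ = 1 := by rw [real_inner_self_eq_norm_sq, hw, one_pow]
  have hwu : ⟪w, u⟫_ℝ = 0 := by rw [real_inner_comm]; exact huw
  -- coordinates of `B u`, `B w`
  set a := ⟪u, B u⟫_ℝ with ha
  set b := ⟪w, B u⟫_ℝ with hb
  set a' := ⟪u, B w⟫_ℝ with ha'
  set b' := ⟪w, B w⟫_ℝ with hb'
  have heBu : ⟪e, B u⟫_ℝ = 0 := by rw [← hBe, B.inner_map_map]; exact heu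
  have heBw : ⟪e, B w⟫_ℝ = 0 := by rw [← hBe, B.inner_map_map]; exact hew
  have hBu : B u = a • u + b • w := by
    have h := hexp (B u); rw [heBu, zero_smul, add_zero] at h; exact h.symm
  have hBw : B w = a' • u + b' • w := by
    have h := hexp (B w); rw [heBw, zero_smul, add_zero] at h; exact h.symm
  -- the three quadratic relations
  have h1 : a ^ 2 + b ^ 2 = 1 := by
    have h := B.inner_map_map u u
    rw [hBu, huu] at h
    simp only [inner_add_left, inner_add_right, real_inner_smul_left, real_inner_smul_right,
      huu, hww, huw, hwu] at h
    nlinarith [h]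
  have h2 : a * a' + b * b' = 0 := by
    have h := B.inner_map_map u w
    rw [hBu, hBw, huw] at h
    simp only [inner_add_left, inner_add_right, real_inner_smul_left, real_inner_smul_right,
      huu, hww, huw, hwu] at h
    nlinarith [h]
  have h3 : a' ^ 2 + b' ^ 2 = 1 := by
    have h := B.inner_map_map w w
    rw [hBw, hww] at h
    simp only [inner_add_left, inner_add_right, real_inner_smul_left, real_inner_smul_right,
      huu, hww, huw, hwu] at h
    nlinarith [h]
  -- `(a', b') = λ (-b, a)` with `λ = ± 1`
  set lam := a * b' - b * a' with hlam
  have ha'l : a' = -lam * b := by linear_combination (-a') * h1 + a * h2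
  have hb'l : b' = lam * a := by linear_combination (-b') * h1 + b * h2
  have hl2 : lam ^ 2 = 1 := by
    linear_combination (a' ^ 2 + b' ^ 2) * h1 + h3 - (a * a' + b * b') * h2
  have hl : lam = 1 ∨ lam = -1 := by
    have : (lam - 1) * (lam + 1) = 0 := by linear_combination hl2
    rcases mul_eq_zero.1 this with h | h
    · exact Or.inl (by linarith)
    · exact Or.inr (by linarith)
  rcases hl with hl | hl
  · -- rotation
    refine ⟨a, b, h1, fun y => ?_⟩
    rw [hl] at ha'l hb'l
    have hy := (hexp y).symm
    set α := ⟪u, y⟫_ℝ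
    set β := ⟪w, y⟫_ℝ
    set γ := ⟪e, y⟫_ℝ
    have hBy : B y = α • B u + β • B w + γ • e := by
      conv_lhs => rw [hy]
      simp only [map_add, map_smul, hBe]
    rw [hBy, hBu, hBw, ha'l, hb'l]
    conv_rhs => rw [hy]
    module
  · -- involution: contradiction
    exfalso
    obtain ⟨x, hx⟩ := hB2
    apply hx
    rw [hl] at ha'l hb'l
    have hBBu : B (B u) = u := by
      rw [hBu, map_add, map_smul, map_smul, hBu, hBw, ha'l, hb'l]
      match_scalars <;> first | linear_combination h1 | linear_combination -h1 | ring
    have hBBw : B (B w) = w := by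
      rw [hBw, map_add, map_smul, map_smul, hBu, hBw, ha'l, hb'l]
      match_scalars <;> first | linear_combination h1 | linear_combination -h1 | ring
    have hy := (hexp x).symm
    conv_lhs => rw [hy]
    simp only [map_add, map_smul, hBe, hBBu, hBBw]
    exact hy.symm



end Summit.NavierStokesRegularity.NavierStokesRegularity.Theorems.PoloidalWindowDoorPoloidalWindowRigidityIsometryAxisRotation
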